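import Summits.Ventures.PercRepro.ExcessOneCompletionSteps

/-!
# The case analysis of Theorem W

Fourth module of Theorem W (proofs/MINE1-theoremS.md, Addendum 12). With `G` tight, `M = Rstar G`,
`Φ = flip M G`, `u` twin-closed with `u, uᶜ ∉ G`, every member other than `M` signable, no
complementary pair among the members other than `M`, full support and empty core, we show that
`M` is `∅` or `univ` (`Rstar_eq_empty_or_univ`). Write `α := u \ M ∈ Φ`, `β := uᶜ \ M ∈ Φ`,
`γ := u ∩ M ∈ Φ`, `δ := M \ u ∈ Φ`; then `u ∈ G ↔ α ∧ δ` and `uᶜ ∈ G ↔ β ∧ γ`, so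
`¬(α ∧ δ)` and `¬(β ∧ γ)`. If `M ≠ ∅, univ`, pick `n ∉ M`, `m ∈ M` with classes `qn`, `qm`
(flipped members by `ExcessOneCompletionSteps.lean`), and the members `qn ∪ M` and `M \ qm`:

* `¬α ∧ ¬δ` (`false_of_not_alpha_not_delta`): `qn ∪ M` is A-signable, giving `γ`, hence `¬β`;
  then `M \ qm` is neither A- nor C*-signable.
* `α ∧ ¬δ` (`false_of_alpha_not_delta`): again `γ` and `¬β`; every `M \ cls m'` (`m' ∈ M`) is
  C*-signable, which forces `m' ∉ u`, so `u ∩ M = ∅`; then `u ≠ ∅` would make `u ∪ M` a member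
  whose A-signability gives `β`; so `u = ∅`, and the A-signability of `qn ∪ M` and the
  C*-signability of `M \ qm` provide the complementary pair of `pair_false`.
* `¬α ∧ δ` (`false_of_not_alpha_delta`): the mirror image, ending with `u = univ`.
-/

namespace PercRepro.MSTight

open Finset
open scoped FinsetFamily symmDiff

variable {α : Type*} [DecidableEq α] [Fintype α]

variable {G : Finset (Finset α)} {M u : Finset α}

/-- Case `¬α ∧ ¬δ`. -/
theorem false_of_not_alpha_not_delta (hT : Tight G) (hM : M = Rstar G) (hutc : TwinClosed G u)
    (huc : Finset.univ \ u ∉ G)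
    (hsign : ∀ t ∈ G, t ≠ M → Cells (G \\ G) t u ∨ Cells (G \\ G) t (Finset.univ \ u))
    (hsupp : ∀ a : α, ∃ t ∈ G, a ∈ t) (hcore : ∀ a : α, ∃ t ∈ G, a ∉ t)
    {n m : α} (hn : n ∉ M) (hm : m ∈ M)
    (hα : u \ M ∉ flip M G) (hδ : M \ u ∉ flip M G) : False := by
  have hMtc : TwinClosed G M := hM ▸ twinClosed_Rstar G
  have hqnΦ := cls_mem_flip_of_notMem_Rstar hT hM hsupp hn
  have hqnM : Disjoint (cls G n) M := disjoint_cls_of_twinClosed_of_notMem hMtc hn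
  have hqmΦ := cls_mem_flip_of_mem_Rstar hT hM hcore hm
  have hqmM : cls G m ⊆ M := cls_subset_of_twinClosed hMtc hm
  have hgn : cls G n ∪ M ∈ G := union_Rstar_mem hM hqnΦ hqnM
  have hgn_ne : cls G n ∪ M ≠ M := by
    intro h
    apply hn
    rw [← h]
    exact mem_union_left M (self_mem_cls G n)
  have hgm : M \ cls G m ∈ G := Rstar_sdiff_mem hM hqmΦ hqmM
  have hgm_ne : M \ cls G m ≠ M := by
    intro h
    have : m ∈ M \ cls G m := by
      rw [h]
      exact hm
    exact (mem_sdiff.1 this).2 (self_mem_cls G m)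
  have hγ : u ∩ M ∈ flip M G := by
    rcases hsign _ hgn hgn_ne with hA | hC
    · exact ((cellsA_union_iff hT hM hutc hgn).1 hA).1
    · exact absurd ((cellsC_union_iff hT hM hutc hgn).1 hC).1 hδ
  have hnβ : (Finset.univ \ u) \ M ∉ flip M G := fun hβ =>
    huc (compl_mem_of_flags hT hM hutc hβ hγ)
  rcases hsign _ hgm hgm_ne with hA | hC
  · exact hnβ ((cellsA_sdiff_iff hT hM hutc hgm).1 hA).2
  · exact hα ((cellsC_sdiff_iff hT hM hutc hgm).1 hC).2

/-- Case `α ∧ ¬δ`. -/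
theorem false_of_alpha_not_delta (hT : Tight G) (hM : M = Rstar G) (hutc : TwinClosed G u)
    (hu : u ∉ G) (huc : Finset.univ \ u ∉ G)
    (hsign : ∀ t ∈ G, t ≠ M → Cells (G \\ G) t u ∨ Cells (G \\ G) t (Finset.univ \ u))
    (hval : ∀ t ∈ G, t ≠ M → Finset.univ \ t ∈ G → Finset.univ \ t = M) (hMΦ : M ∉ flip M G)
    (hsupp : ∀ a : α, ∃ t ∈ G, a ∈ t) (hcore : ∀ a : α, ∃ t ∈ G, a ∉ t)
    {n m : α} (hn : n ∉ M) (hm : m ∈ M)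
    (hα : u \ M ∈ flip M G) (hδ : M \ u ∉ flip M G) : False := by
  have hMtc : TwinClosed G M := hM ▸ twinClosed_Rstar G
  have hqnΦ := cls_mem_flip_of_notMem_Rstar hT hM hsupp hn
  have hqnM : Disjoint (cls G n) M := disjoint_cls_of_twinClosed_of_notMem hMtc hn
  have hqmΦ := cls_mem_flip_of_mem_Rstar hT hM hcore hm
  have hqmM : cls G m ⊆ M := cls_subset_of_twinClosed hMtc hm
  have hgn : cls G n ∪ M ∈ G := union_Rstar_mem hM hqnΦ hqnM
  have hgn_ne : cls G n ∪ M ≠ M := by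
    intro h
    apply hn
    rw [← h]
    exact mem_union_left M (self_mem_cls G n)
  have hgm : M \ cls G m ∈ G := Rstar_sdiff_mem hM hqmΦ hqmM
  have hgm_ne : M \ cls G m ≠ M := by
    intro h
    have : m ∈ M \ cls G m := by
      rw [h]
      exact hm
    exact (mem_sdiff.1 this).2 (self_mem_cls G m)
  -- `qn ∪ M` is A-signable: `γ`, hence `¬β`
  have hγ : u ∩ M ∈ flip M G := by
    rcases hsign _ hgn hgn_ne with hA | hC
    · exact ((cellsA_union_iff hT hM hutc hgn).1 hA).1
    · exact absurd ((cellsC_union_iff hT hM hutc hgn).1 hC).1 hδ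
  have hnβ : (Finset.univ \ u) \ M ∉ flip M G := fun hβ =>
    huc (compl_mem_of_flags hT hM hutc hβ hγ)
  -- every `M \ cls m'` is C*-signable, forcing `m' ∉ u`
  have hMu : ∀ m', m' ∈ M → m' ∉ u := by
    intro m' hm' hm'u
    have hqΦ := cls_mem_flip_of_mem_Rstar hT hM hcore hm'
    have hqM : cls G m' ⊆ M := cls_subset_of_twinClosed hMtc hm'
    have hqu : cls G m' ⊆ u := cls_subset_of_twinClosed hutc hm'u
    have hg : M \ cls G m' ∈ G := Rstar_sdiff_mem hM hqΦ hqM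
    have hg_ne : M \ cls G m' ≠ M := by
      intro h
      have : m' ∈ M \ cls G m' := by
        rw [h]
        exact hm'
      exact (mem_sdiff.1 this).2 (self_mem_cls G m')
    rcases hsign _ hg hg_ne with hA | hC
    · exact hnβ ((cellsA_sdiff_iff hT hM hutc hg).1 hA).2
    · have h1 := ((cellsC_sdiff_iff hT hM hutc hg).1 hC).1
      rw [idW_sdiff_sdiff_of_subset hqu] at h1
      exact hδ h1
  have huM : Disjoint u M := Finset.disjoint_left.2 fun a hau haM => hMu a haM hau
  have huΦ : u ∈ flip M G := by
    rwa [Finset.sdiff_eq_self_of_disjoint huM] at hα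
  -- `u = ∅`: otherwise the member `u ∪ M` would be A-signable, giving `β`
  have hu0 : u = ∅ := by
    by_contra hu0
    obtain ⟨a, ha⟩ : u.Nonempty := Finset.nonempty_iff_ne_empty.2 hu0
    have hg : u ∪ M ∈ G := union_Rstar_mem hM huΦ huM
    have hg_ne : u ∪ M ≠ M := by
      intro h
      apply Finset.disjoint_left.1 huM ha
      rw [← h]
      exact mem_union_left M ha
    rcases hsign _ hg hg_ne with hA | hC
    · have h2 := ((cellsA_union_iff hT hM hutc hg).1 hA).2
      rw [idW_sdiff_sdiff_of_disjoint Finset.disjoint_sdiff M] at h2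
      exact hnβ h2
    · exact hδ ((cellsC_union_iff hT hM hutc hg).1 hC).1
  subst hu0
  -- the complementary pair
  have hN : (Finset.univ \ M) \ cls G n ∈ flip M G := by
    rcases hsign _ hgn hgn_ne with hA | hC
    · have h2 := ((cellsA_union_iff hT hM hutc hgn).1 hA).2
      rwa [Finset.sdiff_empty] at h2
    · exact absurd ((cellsC_union_iff hT hM hutc hgn).1 hC).1 hδ
  have hMq : M \ cls G m ∈ flip M G := by
    rcases hsign _ hgm hgm_ne with hA | hC
    · exact absurd ((cellsA_sdiff_iff hT hM hutc hgm).1 hA).2 hnβ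
    · have h1 := ((cellsC_sdiff_iff hT hM hutc hgm).1 hC).1
      rwa [Finset.sdiff_empty] at h1
  exact pair_false hT hM hval hMΦ (twinClosed_cls G n) (twinClosed_cls G m) hqnΦ hqmΦ hqnM
    hqmM (self_mem_cls G n) hN hMq

/-- Case `¬α ∧ δ`. -/
theorem false_of_not_alpha_delta (hT : Tight G) (hM : M = Rstar G) (hutc : TwinClosed G u)
    (hu : u ∉ G) (huc : Finset.univ \ u ∉ G)
    (hsign : ∀ t ∈ G, t ≠ M → Cells (G \\ G) t u ∨ Cells (G \\ G) t (Finset.univ \ u))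
    (hval : ∀ t ∈ G, t ≠ M → Finset.univ \ t ∈ G → Finset.univ \ t = M) (hMΦ : M ∉ flip M G)
    (hsupp : ∀ a : α, ∃ t ∈ G, a ∈ t) (hcore : ∀ a : α, ∃ t ∈ G, a ∉ t)
    {n m : α} (hn : n ∉ M) (hm : m ∈ M)
    (hα : u \ M ∉ flip M G) (hδ : M \ u ∈ flip M G) : False := by
  have hMtc : TwinClosed G M := hM ▸ twinClosed_Rstar G
  have hqnΦ := cls_mem_flip_of_notMem_Rstar hT hM hsupp hn
  have hqnM : Disjoint (cls G n) M := disjoint_cls_of_twinClosed_of_notMem hMtc hn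
  have hqmΦ := cls_mem_flip_of_mem_Rstar hT hM hcore hm
  have hqmM : cls G m ⊆ M := cls_subset_of_twinClosed hMtc hm
  have hgn : cls G n ∪ M ∈ G := union_Rstar_mem hM hqnΦ hqnM
  have hgn_ne : cls G n ∪ M ≠ M := by
    intro h
    apply hn
    rw [← h]
    exact mem_union_left M (self_mem_cls G n)
  have hgm : M \ cls G m ∈ G := Rstar_sdiff_mem hM hqmΦ hqmM
  have hgm_ne : M \ cls G m ≠ M := by
    intro h
    have : m ∈ M \ cls G m := by
      rw [h]
      exact hm
    exact (mem_sdiff.1 this).2 (self_mem_cls G m)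
  -- `M \ qm` is A-signable: `β`, hence `¬γ`
  have hβ : (Finset.univ \ u) \ M ∈ flip M G := by
    rcases hsign _ hgm hgm_ne with hA | hC
    · exact ((cellsA_sdiff_iff hT hM hutc hgm).1 hA).2
    · exact absurd ((cellsC_sdiff_iff hT hM hutc hgm).1 hC).2 hα
  have hnγ : u ∩ M ∉ flip M G := fun hγ => huc (compl_mem_of_flags hT hM hutc hβ hγ)
  -- every `cls n' ∪ M` (`n' ∉ M`) is C*-signable, forcing `n' ∈ u`
  have hNu : ∀ n', n' ∉ M → n' ∈ u := by
    intro n' hn'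
    have hqΦ := cls_mem_flip_of_notMem_Rstar hT hM hsupp hn'
    have hqM : Disjoint (cls G n') M := disjoint_cls_of_twinClosed_of_notMem hMtc hn'
    have hg : cls G n' ∪ M ∈ G := union_Rstar_mem hM hqΦ hqM
    have hg_ne : cls G n' ∪ M ≠ M := by
      intro h
      apply hn'
      rw [← h]
      exact mem_union_left M (self_mem_cls G n')
    by_contra hn'u
    rcases hsign _ hg hg_ne with hA | hC
    · exact hnγ ((cellsA_union_iff hT hM hutc hg).1 hA).1
    · have h2 := ((cellsC_union_iff hT hM hutc hg).1 hC).2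
      have hqu : Disjoint (cls G n') u := disjoint_cls_of_twinClosed_of_notMem hutc hn'u
      rw [idW_sdiff_sdiff_of_disjoint hqu] at h2
      exact hα h2
  -- and `M ⊆ u`: otherwise the member `M \ (M \ u)` would be A-signable with `γ`
  have hMu : M ⊆ u := by
    by_contra hMu
    have hne'' : (M \ u).Nonempty := by
      rw [Finset.nonempty_iff_ne_empty]
      intro h
      exact hMu (Finset.sdiff_eq_empty_iff_subset.1 h)
    have hg : M \ (M \ u) ∈ G := Rstar_sdiff_mem hM hδ sdiff_subset
    have hg_ne : M \ (M \ u) ≠ M := by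
      intro h
      obtain ⟨a, ha⟩ := hne''
      have : a ∈ M \ (M \ u) := by
        rw [h]
        exact (mem_sdiff.1 ha).1
      exact (mem_sdiff.1 this).2 ha
    rcases hsign _ hg hg_ne with hA | hC
    · have h1 := ((cellsA_sdiff_iff hT hM hutc hg).1 hA).1
      rw [idW_inter_sdiff_sdiff] at h1
      exact hnγ h1
    · exact hα ((cellsC_sdiff_iff hT hM hutc hg).1 hC).2
  have huU : u = Finset.univ := by
    apply Finset.eq_univ_iff_forall.2
    intro a
    by_cases haM : a ∈ M
    · exact hMu haM
    · exact hNu a haM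
  subst huU
  -- the complementary pair
  have hN : (Finset.univ \ M) \ cls G n ∈ flip M G := by
    rcases hsign _ hgn hgn_ne with hA | hC
    · exact absurd ((cellsA_union_iff hT hM hutc hgn).1 hA).1 hnγ
    · exact ((cellsC_union_iff hT hM hutc hgn).1 hC).2
  have hMq : M \ cls G m ∈ flip M G := by
    rcases hsign _ hgm hgm_ne with hA | hC
    · have h1 := ((cellsA_sdiff_iff hT hM hutc hgm).1 hA).1
      rwa [Finset.inter_univ] at h1
    · exact absurd ((cellsC_sdiff_iff hT hM hutc hgm).1 hC).2 hα
  exact pair_false hT hM hval hMΦ (twinClosed_cls G n) (twinClosed_cls G m) hqnΦ hqmΦ hqnM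
    hqmM (self_mem_cls G n) hN hMq

/-- **The addable part is `∅` or `univ`.** -/
theorem Rstar_eq_empty_or_univ (hT : Tight G) (hM : M = Rstar G) (hutc : TwinClosed G u)
    (hu : u ∉ G) (huc : Finset.univ \ u ∉ G)
    (hsign : ∀ t ∈ G, t ≠ M → Cells (G \\ G) t u ∨ Cells (G \\ G) t (Finset.univ \ u))
    (hval : ∀ t ∈ G, t ≠ M → Finset.univ \ t ∈ G → Finset.univ \ t = M)
    (hsupp : ∀ a : α, ∃ t ∈ G, a ∈ t) (hcore : ∀ a : α, ∃ t ∈ G, a ∉ t) :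
    M = ∅ ∨ M = Finset.univ := by
  by_cases hM0 : M = ∅
  · exact Or.inl hM0
  by_cases hMU : M = Finset.univ
  · exact Or.inr hMU
  exfalso
  obtain ⟨m, hm⟩ : M.Nonempty := Finset.nonempty_iff_ne_empty.2 hM0
  obtain ⟨n, hn⟩ : ∃ n, n ∉ M := by
    by_contra h
    exact hMU (Finset.eq_univ_iff_forall.2 fun a => by_contra fun ha => h ⟨a, ha⟩)
  have hMΦ : M ∉ flip M G := Rstar_notMem_flip hT hM hutc hu huc hM0 hsign
  by_cases hδ : M \ u ∈ flip M G
  · by_cases hα : u \ M ∈ flip M G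
    · exact hu (mem_of_flags hT hM hutc hα hδ)
    · exact false_of_not_alpha_delta hT hM hutc hu huc hsign hval hMΦ hsupp hcore hn hm hα hδ
  · by_cases hα : u \ M ∈ flip M G
    · exact false_of_alpha_not_delta hT hM hutc hu huc hsign hval hMΦ hsupp hcore hn hm hα hδ
    · exact false_of_not_alpha_not_delta hT hM hutc huc hsign hsupp hcore hn hm hα hδ

end PercRepro.MSTight
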